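import Literature.Algebra.Homology.DiscreteRepLayerColimitDesc
import Literature.Algebra.Homology.DiscreteRepLayerBoundary
import Literature.Algebra.Homology.DiscreteRepContinuous
import Literature.NumberTheory.GaloisRepresentations.ContinuousH1DiscreteGroup
import Literature.NumberTheory.GaloisRepresentations.DiscreteCochains
import Mathlib.Topology.Algebra.ClopenNhdofOne
import HarnessLib

/-!
# `Ext¹_{C_Γ}(k, M) ≃+ H¹_cont(Γ, M)` BY DESCENT OF THE LAYER INFLATIONS, for ANY profinite group `Γ`
# (Serre, *Galois Cohomology* I §2.2 Prop. 8 and Cor. 1, §2.6 (b), in degree one)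

Topic `Algebra/Homology`; namespace `Literature.Algebra.Homology.DiscreteRep.ExtOneLayer`.
Definitions WITH BODIES (`layerInf`, `inflateCocycle`, `homD`, `extOneToH1`, `extOneEquivH1`) and theorems;
no named fact, no instance, no notation, no `sorry`.

THE MATHEMATICS.  Let `Γ` be a profinite group (compact, totally disconnected topological group), `k` a
commutative ring and `ρ` a continuous representation of `Γ` on a DISCRETE `k`-module `V` (an object
`ofContinuousRep ρ` of door-c4's abelian category `C_Γ = DiscreteRepCat k Γ`).  For an open normal subgroup
`U ⊴ Γ` the layer `V^U` is a module over the finite discrete group `Γ ⧸ U`, and Mathlib's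
`H¹(Γ ⧸ U, V^U)` (`groupCohomology`, inhomogeneous cochains) inflates to Mathlib's continuous
`H¹_cont(Γ, V) = continuousCohomology 1 ρ.toTopRep` (**`layerInf ρ U`**, cocycle formula
**`layerInf_H1π : inf_U [γ] = [σ ↦ γ(σ̄)]`**).  These maps are injective (inflation–restriction in degree
`1`, `layerInf_injective`), compatible with the inflation transitions `stepG` of door-c4's colimit
presentation `Ext¹_{C_Γ}(k, V) = lim→_U H¹(Γ ⧸ U, V^U)` (`isCompatibleFamily_layerInf`) and jointly
surjective (`exists_layerInf_eq`: a continuous crossed homomorphism of a profinite group into a discrete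
module factors through a finite layer, Serre I §2.2 Cor. 1).  By the universal property of the colimit
(`LayerColimit.desc`) they descend to an additive BIJECTION

  **`extOneToH1 ρ : Ext¹_{C_Γ}(k, V) →+ H¹_cont(Γ, V)`,  `extOneToH1 ρ (inflG U [γ]) = [σ ↦ γ(σ̄)]`**

(`extOneToH1_inflG(_H1π)`, `extOneToH1_bijective`, `extOneEquivH1`), NATURAL in the module
(`extOneToH1_naturality`, `extOneEquivH1_symm_naturality`: for a morphism `F` of topological
representations, `H¹(F) ∘ Φ_ρ = Φ_{ρ'} ∘ (· ∘ F)`).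

This is the generic form (any profinite `Γ`, any `k`) of door-c5's `OpenLayer.extOneToGaloisCohomology`
(`GaloisCohomologyInflationColimit`, `Γ = Γ_K`, `k = ℤ`) and door-c4 g18's `ExtOneDescent.extOneToH1`; it is
written for the group `G_S = Γ_K ⧸ N_S` of restricted ramification (lane «PT-Ш-S-TC» of cell `bsd-eis`, crux
`GoodLatticeBDPValue`, brick D4b/F2d: the degree-`1` bridge `nat_S : H¹(G_S, A) ≅ Ext¹_{C_{G_S}}(ℤ, A)` of the
`Ext` road in LAYER currency, so that the reciprocity law (R4)_S can be read on layer cocycles).  The tree's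
ABSTRACT comparison `DiscreteRep.extTrivAddEquivContinuousCohomology` (acyclic-resolution road) is another
such bijection; its compatibility with `inflG` is not proved in the tree, which is why the explicit descent is
recorded here.  HONEST FRAMING: homological bookkeeping (Serre's `H¹(Γ, V) = lim→ H¹(Γ/U, V^U)` made
explicit); no arithmetic statement, no case of Poitou–Tate duality or BSD is proved here.
AI formalisation, weaker than expert review; established only by the kernel check.

## References
* J.-P. Serre, *Galois Cohomology* (1997), I §2.2 Proposition 8 and Corollary 1, I §2.6 (b).
  [SerreGaloisCohomology1997]
* J. Neukirch, A. Schmidt, K. Wingberg, *Cohomology of Number Fields* (2nd ed. 2008), (1.5.1), (1.6.7).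
  [NeukirchSchmidtWingberg2008]
* D. Harari, *Galois Cohomology and Class Field Theory* (2020), §4.3 Proposition 4.18, Remark 4.24. [Harari2020]
-/

noncomputable section

universe u

namespace Literature.Algebra.Homology

namespace DiscreteRep

namespace ExtOneLayer

open CategoryTheory CategoryTheory.Abelian groupCohomology Function Topology
open Literature.NumberTheory.GaloisRepresentations

variable {k Γ : Type u} [CommRing k] [TopologicalSpace k] [Group Γ] [TopologicalSpace Γ] [IsTopologicalGroup Γ]
  {V : Type u} [AddCommGroup V] [Module k V] [TopologicalSpace V] [DiscreteTopology V] [ContinuousSMul k V]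
  {V' : Type u} [AddCommGroup V'] [Module k V'] [TopologicalSpace V'] [DiscreteTopology V'] [ContinuousSMul k V']
  (ρ : ContinuousRep Γ k V) (ρ' : ContinuousRep Γ k V')

/-! ## §1 The layer inflation `H¹(Γ ⧸ U, V^U) →+ H¹_cont(Γ, V)` for an open normal subgroup `U` -/

omit [ContinuousSMul k V] in
/-- The layer `V^U` of the colimit presentation of `ofContinuousRep ρ` IS (`rfl`) `Rep.of` of the tree's
`ρ.quotientInvariants U` (the `Γ ⧸ U`-module `V^U`). [cite: SerreGaloisCohomology1997, I §2.2 Proposition 8] -/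
theorem layer_eq (U : OpenNormalSubgroup Γ) :
    (invariantsQuotFunctor k (U : Subgroup Γ)).obj (ofContinuousRep ρ) =
      Rep.of (ρ.quotientInvariants (U : Subgroup Γ)).toRepresentation := rfl

/-- **The layer inflation `inf_U : H¹(Γ ⧸ U, V^U) →+ H¹_cont(Γ, V)`** from Mathlib's `groupCohomology` of the
layer (discrete/continuous comparison `H1DiscreteEquiv` for the discrete group `Γ ⧸ U`, then Mathlib's
`ContinuousCohomology.map` along `(Γ ↠ Γ ⧸ U, V^U ⊆ V)`).
[cite: SerreGaloisCohomology1997, I §2.2 Proposition 8][cite: NeukirchSchmidtWingberg2008, (1.5.1)] -/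
def layerInf (U : OpenNormalSubgroup Γ) :
    groupCohomology ((invariantsQuotFunctor k (U : Subgroup Γ)).obj (ofContinuousRep ρ)) 1 →+
      continuousCohomology 1 ρ.toTopRep :=
  haveI : DiscreteTopology (Γ ⧸ (U : Subgroup Γ)) := QuotientGroup.discreteTopology U.isOpen
  (ContinuousCohomology.map (ContinuousMonoidHom.quotientMk (U : Subgroup Γ))
      (X := (ρ.quotientInvariants (U : Subgroup Γ)).toTopRep) (Y := ρ.toTopRep)
      (TopRep.ofHom ⟨Submodule.subtypeL _, fun _ => rfl⟩) 1).hom.toLinearMap.toAddMonoidHom.comp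
    (H1DiscreteEquiv (ρ.quotientInvariants (U : Subgroup Γ)).toRepresentation
      (ρ.quotientInvariants (U : Subgroup Γ)).toContRepresentation (fun _ _ => rfl)).toAddMonoidHom

/-- The inflated crossed homomorphism `σ ↦ γ(σ̄) ∈ V` of a layer `1`-cocycle `γ`, as a continuous `1`-cocycle
of `Γ`. [cite: SerreGaloisCohomology1997, I §2.2] -/
def inflateCocycle (U : OpenNormalSubgroup Γ)
    (γ : cocycles₁ ((invariantsQuotFunctor k (U : Subgroup Γ)).obj (ofContinuousRep ρ))) :
    contOneCocycles ρ.toTopRep :=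
  haveI : DiscreteTopology (Γ ⧸ (U : Subgroup Γ)) := QuotientGroup.discreteTopology U.isOpen
  contOneCocycles.pullback (ContinuousMonoidHom.quotientMk (U : Subgroup Γ))
    (X := (ρ.quotientInvariants (U : Subgroup Γ)).toTopRep) (Y := ρ.toTopRep)
    (TopRep.ofHom ⟨Submodule.subtypeL _, fun _ => rfl⟩)
    (cocycles₁ToContOneCocycles (ρ.quotientInvariants (U : Subgroup Γ)).toRepresentation
      (ρ.quotientInvariants (U : Subgroup Γ)).toContRepresentation (fun _ _ => rfl) γ)

/-- Unfolding: `inflateCocycle γ σ = γ(σ̄)` in `V`. [cite: SerreGaloisCohomology1997, I §2.2] -/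
@[simp] theorem inflateCocycle_apply (U : OpenNormalSubgroup Γ)
    (γ : cocycles₁ ((invariantsQuotFunctor k (U : Subgroup Γ)).obj (ofContinuousRep ρ))) (σ : Γ) :
    (inflateCocycle ρ U γ).1 σ =
      Subtype.val ((γ : (Γ ⧸ (U : Subgroup Γ)) → _) (σ : Γ ⧸ (U : Subgroup Γ))) := rfl

/-- **Cocycle formula `inf_U [γ] = [σ ↦ γ(σ̄)]`.** [cite: SerreGaloisCohomology1997, I §2.2 Proposition 8]
[cite: NeukirchSchmidtWingberg2008, (1.5.1)] -/
theorem layerInf_H1π (U : OpenNormalSubgroup Γ)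
    (γ : cocycles₁ ((invariantsQuotFunctor k (U : Subgroup Γ)).obj (ofContinuousRep ρ))) :
    layerInf ρ U (H1π _ γ) = oneCocycleClass ρ.toTopRep (inflateCocycle ρ U γ) := by
  haveI : DiscreteTopology (Γ ⧸ (U : Subgroup Γ)) := QuotientGroup.discreteTopology U.isOpen
  change (ContinuousCohomology.map (ContinuousMonoidHom.quotientMk (U : Subgroup Γ))
      (X := (ρ.quotientInvariants (U : Subgroup Γ)).toTopRep) (Y := ρ.toTopRep)
      (TopRep.ofHom ⟨Submodule.subtypeL _, fun _ => rfl⟩) 1)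
    (H1DiscreteEquiv (ρ.quotientInvariants (U : Subgroup Γ)).toRepresentation
      (ρ.quotientInvariants (U : Subgroup Γ)).toContRepresentation (fun _ _ => rfl)
      (H1π (Rep.of (ρ.quotientInvariants (U : Subgroup Γ)).toRepresentation) γ)) = _
  rw [H1DiscreteEquiv_H1π]
  exact map_oneCocycleClass (ContinuousMonoidHom.quotientMk (U : Subgroup Γ))
    (X := (ρ.quotientInvariants (U : Subgroup Γ)).toTopRep) (Y := ρ.toTopRep)
    (TopRep.ofHom ⟨Submodule.subtypeL _, fun _ => rfl⟩) _

/-- **`inf_U` is injective** (inflation–restriction in degree `1`, for ANY topological group and normal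
subgroup: a layer crossed homomorphism whose inflation is principal, `γ(σ̄) = σ • v - v`, takes `σ ∈ U` to
`0`, so `v ∈ V^U` and `γ` is principal). [cite: SerreGaloisCohomology1997, I §2.6 (b)]
[cite: NeukirchSchmidtWingberg2008, (1.6.7)] -/
theorem layerInf_injective (U : OpenNormalSubgroup Γ) : Injective (layerInf ρ U) := by
  refine (injective_iff_map_eq_zero _).2 fun c hc => ?_
  induction c using H1_induction_on with
  | h γ =>
    rw [layerInf_H1π, oneCocycleClass_eq_zero_iff] at hc
    obtain ⟨v, hv⟩ := hc
    -- `v ∈ V^U`: for `u ∈ U`, `γ(ū) = γ(1) = 0 = u • v - v`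
    have hvU : v ∈ ρ.invariantsOf (U : Subgroup Γ) := fun u => by
      have h := hv (u : Γ)
      rw [inflateCocycle_apply, (QuotientGroup.eq_one_iff (u : Γ)).2 u.2, cocycles₁_map_one] at h
      change (0 : V) = ρ (u : Γ) v - v at h
      rw [eq_comm, sub_eq_zero] at h
      exact h
    refine (H1π_eq_zero_iff _).2 ⟨⟨v, hvU⟩, funext fun q => ?_⟩
    induction q using QuotientGroup.induction_on with
    | H σ =>
      refine Subtype.ext ?_
      have h := hv σ
      rw [inflateCocycle_apply] at h
      rw [h]
      rfl

/-- **Compatibility with the inflation transitions**: `inf_W ∘ Inf_{U → W} = inf_U` for `W ≤ U` (both send `[γ]`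
to `[σ ↦ γ(σ̄)]`). [cite: SerreGaloisCohomology1997, I §2.2 Proposition 8] -/
theorem layerInf_stepG (U W : OpenNormalSubgroup Γ) (h : (W : Subgroup Γ) ≤ U)
    (c : groupCohomology ((invariantsQuotFunctor k (U : Subgroup Γ)).obj (ofContinuousRep ρ)) 1) :
    layerInf ρ W (LayerColimit.stepG U W h (ofContinuousRep ρ) 1 c) = layerInf ρ U c := by
  induction c using H1_induction_on with
  | h γ =>
    change layerInf ρ W (groupCohomology.map _ _ 1 (H1π _ γ)) = _
    rw [H1π_comp_map_apply, layerInf_H1π, layerInf_H1π]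
    exact congrArg _ (Subtype.ext (ContinuousMap.ext fun σ => rfl))

/-- **The layer inflations form a compatible family on all open normal subgroups**
(`LayerColimit.IsCompatibleFamily`). [cite: SerreGaloisCohomology1997, I §2.2 Proposition 8] -/
theorem isCompatibleFamily_layerInf :
    LayerColimit.IsCompatibleFamily (fun U : OpenNormalSubgroup Γ => U) (ofContinuousRep ρ) 1
      (fun U => layerInf ρ U) :=
  ⟨fun W => ⟨W, le_rfl⟩, fun U W h c => layerInf_stepG ρ U W h c⟩

/-! ## §1b Every class of `H¹_cont(Γ, V)` is inflated from a finite layer (`Γ` profinite) -/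

section Profinite

variable [CompactSpace Γ] [TotallyDisconnectedSpace Γ]

/-- **`H¹_cont(Γ, V)` is the union of the layer inflations** (Serre I §2.2 Cor. 1 to Prop. 8 in degree `1`): a
continuous crossed homomorphism `φ : Γ → V` into a DISCRETE module vanishes on some open normal subgroup
`U` (`φ⁻¹ 0` is a neighbourhood of `1`; a profinite group has a basis of open normal subgroups, Mathlib
`ProfiniteGrp.exist_openNormalSubgroup_sub_open_nhds_of_one`), the cocycle identity then gives
`φ (σ u) = φ σ = φ (u σ)` and `u • φ σ = φ σ` for `u ∈ U`, so `φ` descends to a crossed homomorphism of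
`Γ ⧸ U` with values in `V^U`, whose inflation is `[φ]`. [cite: SerreGaloisCohomology1997, I §2.2 Corollary 1]
[cite: NeukirchSchmidtWingberg2008, (1.5.1)] -/
theorem exists_layerInf_eq (x : continuousCohomology 1 ρ.toTopRep) :
    ∃ (U : OpenNormalSubgroup Γ)
      (c : groupCohomology ((invariantsQuotFunctor k (U : Subgroup Γ)).obj (ofContinuousRep ρ)) 1),
      layerInf ρ U c = x := by
  -- a continuous crossed homomorphism `φ : Γ → V` representing the class
  obtain ⟨φ, rfl⟩ := oneCocycleClass_surjective ρ.toTopRep x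
  have hφ : ∀ g h, φ.1 (g * h) = φ.1 g + ρ g (φ.1 h) := φ.2
  -- an open normal subgroup `U ⊆ φ⁻¹ 0`
  obtain ⟨U, hU⟩ := ProfiniteGrp.exist_openNormalSubgroup_sub_open_nhds_of_one
    ((isOpen_discrete ({0} : Set V)).preimage φ.1.continuous) (contOneCocycles.apply_one φ)
  have hNU : ∀ u ∈ (U : Subgroup Γ), φ.1 u = 0 := fun u hu => hU hu
  haveI : DiscreteTopology (Γ ⧸ (U : Subgroup Γ)) := QuotientGroup.discreteTopology U.isOpen
  -- `φ` is constant on `U`-cosets and takes values in `V^U`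
  have hr : ∀ a, ∀ u ∈ (U : Subgroup Γ), φ.1 (a * u) = φ.1 a := fun a u hu => by
    rw [hφ, hNU u hu, map_zero, add_zero]
  have hl : ∀ a, ∀ u ∈ (U : Subgroup Γ), φ.1 (u * a) = φ.1 a := fun a u hu => by
    rw [show u * a = a * (a⁻¹ * u * a) by group]
    exact hr a _ (Subgroup.Normal.conj_mem' inferInstance u hu a)
  have hv : ∀ a, ∀ u ∈ (U : Subgroup Γ), ρ u (φ.1 a) = φ.1 a := fun a u hu => by
    have h := hφ u a
    rwa [hNU u hu, zero_add, hl a u hu, eq_comm] at h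
  -- descend `φ` to a crossed homomorphism `ψ` of the discrete group `Γ ⧸ U` into `V^U`
  have hmem : ∀ a, φ.1 a ∈ ρ.invariantsOf (U : Subgroup Γ) := fun a u => hv a u.1 u.2
  let ψfun : Γ ⧸ (U : Subgroup Γ) → ρ.invariantsOf (U : Subgroup Γ) := fun q => ⟨φ.1 q.out, hmem _⟩
  have hψ : ∀ a : Γ, (ψfun (a : Γ ⧸ (U : Subgroup Γ)) : V) = φ.1 a := fun a => by
    obtain ⟨u, hu⟩ := QuotientGroup.mk_out_eq_mul (U : Subgroup Γ) a
    simp only [ψfun]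
    rw [hu, hr _ _ u.2]
  let ψ : contOneCocycles (ρ.quotientInvariants (U : Subgroup Γ)).toTopRep :=
    ⟨⟨ψfun, continuous_of_discreteTopology⟩, fun g h => by
      induction g using QuotientGroup.induction_on with | H g => ?_
      induction h using QuotientGroup.induction_on with | H h => ?_
      refine Subtype.ext ?_
      change (ψfun ((g : Γ ⧸ (U : Subgroup Γ)) * (h : Γ ⧸ (U : Subgroup Γ))) : V) =
        (ψfun g : V) + ((ρ.quotientInvariants (U : Subgroup Γ) (g : Γ ⧸ (U : Subgroup Γ)) (ψfun h) :
          ρ.invariantsOf (U : Subgroup Γ)) : V)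
      rw [← QuotientGroup.mk_mul, hψ, hψ, ContinuousRep.quotientInvariants_apply_coe, hψ]
      exact hφ g h⟩
  refine ⟨U, (H1DiscreteEquiv (ρ.quotientInvariants (U : Subgroup Γ)).toRepresentation
      (ρ.quotientInvariants (U : Subgroup Γ)).toContRepresentation (fun _ _ => rfl)).symm
    (oneCocycleClass _ ψ), ?_⟩
  -- `inf_U [ψ] = [ψ ∘ (Γ → Γ ⧸ U)] = [φ]`
  change (ContinuousCohomology.map (ContinuousMonoidHom.quotientMk (U : Subgroup Γ)) _ 1)
    ((H1DiscreteEquiv (ρ.quotientInvariants (U : Subgroup Γ)).toRepresentation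
      (ρ.quotientInvariants (U : Subgroup Γ)).toContRepresentation (fun _ _ => rfl))
      ((H1DiscreteEquiv (ρ.quotientInvariants (U : Subgroup Γ)).toRepresentation
      (ρ.quotientInvariants (U : Subgroup Γ)).toContRepresentation (fun _ _ => rfl)).symm
        (oneCocycleClass _ ψ))) = oneCocycleClass _ φ
  rw [LinearEquiv.apply_symm_apply, map_oneCocycleClass]
  congr 1
  refine Subtype.ext (ContinuousMap.ext fun a => ?_)
  rw [contOneCocycles.pullback_apply]
  exact hψ a

/-! ## §2 The descended map `Φ : Ext¹_{C_Γ}(k, V) →+ H¹_cont(Γ, V)`, its values on inflated classes, bijectivity -/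

/-- **`Φ = extOneToH1 ρ : Ext¹_{C_Γ}(k, V) →+ H¹_cont(Γ, V)`**, the layer inflations descended along
`Ext¹_{C_Γ}(k, V) = lim→_U H¹(Γ ⧸ U, V^U)` (`LayerColimit.desc`). [cite: SerreGaloisCohomology1997, I §2.2 Proposition 8]
[cite: Harari2020, §4.3 Proposition 4.18] -/
def extOneToH1 : Ext (triv (Γ := Γ) k) (ofContinuousRep ρ) 1 →+ continuousCohomology 1 ρ.toTopRep :=
  LayerColimit.desc (fun U : OpenNormalSubgroup Γ => U) (ofContinuousRep ρ) 1 (fun U => layerInf ρ U)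
    (isCompatibleFamily_layerInf ρ)

/-- **`Φ (Inf_U c) = inf_U c`.** [cite: SerreGaloisCohomology1997, I §2.2 Proposition 8] -/
theorem extOneToH1_inflG (U : OpenNormalSubgroup Γ)
    (c : groupCohomology ((invariantsQuotFunctor k (U : Subgroup Γ)).obj (ofContinuousRep ρ)) 1) :
    extOneToH1 ρ (LayerColimit.inflG U (ofContinuousRep ρ) 1 c) = layerInf ρ U c :=
  LayerColimit.desc_inflG (V := fun U : OpenNormalSubgroup Γ => U) (isCompatibleFamily_layerInf ρ) U c

/-- **`Φ (Inf_U [γ]) = [σ ↦ γ(σ̄)]`** — the value on a layer cocycle class is the class of the inflated cocycle.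
[cite: SerreGaloisCohomology1997, I §2.2 Proposition 8][cite: NeukirchSchmidtWingberg2008, (1.5.1)] -/
theorem extOneToH1_inflG_H1π (U : OpenNormalSubgroup Γ)
    (γ : cocycles₁ ((invariantsQuotFunctor k (U : Subgroup Γ)).obj (ofContinuousRep ρ))) :
    extOneToH1 ρ (LayerColimit.inflG U (ofContinuousRep ρ) 1 (H1π _ γ)) =
      oneCocycleClass ρ.toTopRep (inflateCocycle ρ U γ) := by
  rw [extOneToH1_inflG, layerInf_H1π]

/-- `Φ` evaluated through a cocycle whose values are prescribed: if a continuous `1`-cocycle `z` of `Γ`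
satisfies `z σ = γ(σ̄)` for a layer cocycle `γ`, then `Φ (Inf_U [γ]) = [z]`. [cite: SerreGaloisCohomology1997, I §2.2 Proposition 8] -/
theorem extOneToH1_inflG_H1π_eq_of_apply (U : OpenNormalSubgroup Γ)
    (γ : cocycles₁ ((invariantsQuotFunctor k (U : Subgroup Γ)).obj (ofContinuousRep ρ)))
    (z : contOneCocycles ρ.toTopRep)
    (hz : ∀ σ : Γ, z.1 σ = Subtype.val ((γ : (Γ ⧸ (U : Subgroup Γ)) → _) (σ : Γ ⧸ (U : Subgroup Γ)))) :
    extOneToH1 ρ (LayerColimit.inflG U (ofContinuousRep ρ) 1 (H1π _ γ)) = oneCocycleClass ρ.toTopRep z := by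
  rw [extOneToH1_inflG_H1π]
  exact congrArg _ (Subtype.ext (ContinuousMap.ext fun σ => (hz σ).symm))

/-- The additive map agreeing with the layer inflations on inflated classes IS `Φ` (uniqueness of the descent).
[cite: SerreGaloisCohomology1997, I §2.2 Proposition 8] -/
theorem eq_extOneToH1_of_forall_inflG (g : Ext (triv (Γ := Γ) k) (ofContinuousRep ρ) 1 →+ continuousCohomology 1 ρ.toTopRep)
    (hg : ∀ (U : OpenNormalSubgroup Γ)
      (c : groupCohomology ((invariantsQuotFunctor k (U : Subgroup Γ)).obj (ofContinuousRep ρ)) 1),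
      g (LayerColimit.inflG U (ofContinuousRep ρ) 1 c) = layerInf ρ U c) :
    g = extOneToH1 ρ :=
  LayerColimit.eq_desc_of_forall_inflG (V := fun U : OpenNormalSubgroup Γ => U) (isCompatibleFamily_layerInf ρ) g hg

/-- **`Φ` is injective** (every layer inflation is). [cite: SerreGaloisCohomology1997, I §2.6 (b)]
[cite: Harari2020, §4.3 Proposition 4.18] -/
theorem extOneToH1_injective : Injective (extOneToH1 ρ) :=
  LayerColimit.desc_injective (isCompatibleFamily_layerInf ρ) fun U => layerInf_injective ρ U

/-- **`Φ` is surjective** (every class of `H¹_cont(Γ, V)` is inflated from a layer).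
[cite: SerreGaloisCohomology1997, I §2.2 Corollary 1] -/
theorem extOneToH1_surjective : Surjective (extOneToH1 ρ) :=
  LayerColimit.desc_surjective (isCompatibleFamily_layerInf ρ) fun x => exists_layerInf_eq ρ x

/-- **`Φ : Ext¹_{C_Γ}(k, V) → H¹_cont(Γ, V)` is bijective.** [cite: SerreGaloisCohomology1997, I §2.2 Proposition 8, §2.6 (b)]
[cite: Harari2020, §4.3 Proposition 4.18] -/
theorem extOneToH1_bijective : Bijective (extOneToH1 ρ) :=
  ⟨extOneToH1_injective ρ, extOneToH1_surjective ρ⟩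

/-- **`Ext¹_{C_Γ}(k, V) ≃+ H¹_cont(Γ, V)`** (the additive equivalence of `Φ`). [cite: SerreGaloisCohomology1997, I §2.2 Proposition 8]
[cite: Harari2020, §4.3 Proposition 4.18] -/
def extOneEquivH1 : Ext (triv (Γ := Γ) k) (ofContinuousRep ρ) 1 ≃+ continuousCohomology 1 ρ.toTopRep :=
  AddEquiv.ofBijective (extOneToH1 ρ) (extOneToH1_bijective ρ)

/-- `extOneEquivH1` is `Φ`. [cite: SerreGaloisCohomology1997, I §2.2 Proposition 8] -/
@[simp] theorem extOneEquivH1_apply (x : Ext (triv (Γ := Γ) k) (ofContinuousRep ρ) 1) :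
    extOneEquivH1 ρ x = extOneToH1 ρ x := rfl

/-- `Φ (Φ⁻¹ y) = y`. [cite: SerreGaloisCohomology1997, I §2.2 Proposition 8] -/
theorem extOneToH1_symm_apply (y : continuousCohomology 1 ρ.toTopRep) :
    extOneToH1 ρ ((extOneEquivH1 ρ).symm y) = y :=
  (extOneEquivH1 ρ).apply_symm_apply y

omit [ContinuousSMul k V] in
/-- **Every class of `Ext¹_{C_Γ}(k, V)` is inflated from a cocycle of ANY sufficiently small layer**: for `x` and an
open normal `W` there are `U ≤ W` and a layer cocycle `γ ∈ Z¹(Γ ⧸ U, V^U)` with `Inf_U [γ] = x`.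
[cite: SerreGaloisCohomology1997, I §2.2 Proposition 8 and Corollary 1] -/
theorem exists_inflG_H1π_le_eq (W : OpenNormalSubgroup Γ) (x : Ext (triv (Γ := Γ) k) (ofContinuousRep ρ) 1) :
    ∃ (U : OpenNormalSubgroup Γ) (_ : (U : Subgroup Γ) ≤ W)
      (γ : cocycles₁ ((invariantsQuotFunctor k (U : Subgroup Γ)).obj (ofContinuousRep ρ))),
      LayerColimit.inflG U (ofContinuousRep ρ) 1 (H1π _ γ) = x := by
  obtain ⟨U₀, c₀, rfl⟩ := LayerColimit.exists_inflG_eq 1 (ofContinuousRep ρ) x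
  have hle : ((U₀ ⊓ W : OpenNormalSubgroup Γ) : Subgroup Γ) ≤ U₀ := LayerColimit.coe_le_coe_of_le inf_le_left
  refine ⟨U₀ ⊓ W, LayerColimit.coe_le_coe_of_le inf_le_right, ?_⟩
  induction h : LayerColimit.stepG U₀ (U₀ ⊓ W) hle (ofContinuousRep ρ) 1 c₀ using H1_induction_on with
  | h γ => exact ⟨γ, by rw [← h, LayerColimit.inflG_stepG]⟩

end Profinite

/-! ## §3 Naturality in the module -/

/-- A morphism of topological representations as a morphism of `C_Γ` between the attached objects (door-c4's
`stdBaseMap`, the lane's `RestrictedExtTriv.quotientInvariantsMap`: all `ObjectProperty.homMk` of the forgetful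
image, definitionally). [cite: Harari2020, §4.2] -/
def homD (F : ρ.toTopRep ⟶ ρ'.toTopRep) : ofContinuousRep ρ ⟶ ofContinuousRep ρ' :=
  ObjectProperty.homMk (X := ofContinuousRep ρ) (Y := ofContinuousRep ρ') (Rep.ofHom F.hom.toIntertwiningMap)

omit [IsTopologicalGroup Γ] in
/-- `homD F` is `F` on elements. [cite: Harari2020, §4.2] -/
@[simp] theorem homD_hom_apply (F : ρ.toTopRep ⟶ ρ'.toTopRep) (v : V) : (homD ρ ρ' F).hom.hom v = F.hom v := rfl

/-- **Naturality of the layer inflations in the module**: `H¹(F) (inf_U c) = inf_U (H¹(Γ ⧸ U, F^U) c)`.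
[cite: SerreGaloisCohomology1997, I §2.2 Proposition 8][cite: NeukirchSchmidtWingberg2008, (1.5.1)] -/
theorem map_layerInf (F : ρ.toTopRep ⟶ ρ'.toTopRep) (U : OpenNormalSubgroup Γ)
    (c : groupCohomology ((invariantsQuotFunctor k (U : Subgroup Γ)).obj (ofContinuousRep ρ)) 1) :
    (ContinuousCohomology.map (ContinuousMonoidHom.id Γ) F 1).hom (layerInf ρ U c) =
      layerInf ρ' U ((groupCohomology.map (MonoidHom.id _)
        ((invariantsQuotFunctor k (U : Subgroup Γ)).map (homD ρ ρ' F)) 1).hom c) := by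
  induction c using H1_induction_on with
  | h γ =>
    change _ = layerInf ρ' U (groupCohomology.map _ _ 1 (H1π _ γ))
    rw [H1π_comp_map_apply, layerInf_H1π, layerInf_H1π]
    change (ContinuousCohomology.map (ContinuousMonoidHom.id Γ) F 1) (oneCocycleClass ρ.toTopRep (inflateCocycle ρ U γ)) = _
    rw [map_oneCocycleClass]
    exact congrArg _ (Subtype.ext (ContinuousMap.ext fun σ => rfl))

section ProfiniteNat

variable [CompactSpace Γ] [TotallyDisconnectedSpace Γ]

/-- **Naturality of `Φ` in the module**: `H¹(F) (Φ_ρ x) = Φ_{ρ'} (x ∘ F)` for a morphism `F : ρ ⟶ ρ'` of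
topological representations (Mathlib's `ContinuousCohomology.map (id Γ) F` on the right-hand side, composition
with `homD F` in `C_Γ` on the `Ext` side). [cite: SerreGaloisCohomology1997, I §2.2 Proposition 8]
[cite: Harari2020, §4.3 Remark 4.24] -/
theorem extOneToH1_naturality (F : ρ.toTopRep ⟶ ρ'.toTopRep) (x : Ext (triv (Γ := Γ) k) (ofContinuousRep ρ) 1) :
    (ContinuousCohomology.map (ContinuousMonoidHom.id Γ) F 1).hom (extOneToH1 ρ x) =
      extOneToH1 ρ' (x.comp (Ext.mk₀ (homD ρ ρ' F)) (add_zero 1)) := by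
  obtain ⟨U, c, rfl⟩ := LayerColimit.exists_inflG_eq 1 (ofContinuousRep ρ) x
  rw [extOneToH1_inflG, map_layerInf, ← LayerColimit.inflG_map, extOneToH1_inflG]

/-- **The same for the inverse `Φ⁻¹ : H¹_cont(Γ, V) → Ext¹_{C_Γ}(k, V)`**: `Φ⁻¹_{ρ'} (H¹(F) y) = (Φ⁻¹_ρ y) ∘ F` — the
shape of the hypothesis `hnatG` of the lane's `ShaExtRoad.pairing_natural`. [cite: SerreGaloisCohomology1997, I §2.2 Proposition 8]
[cite: Harari2020, §4.3 Remark 4.24] -/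
theorem extOneEquivH1_symm_naturality (F : ρ.toTopRep ⟶ ρ'.toTopRep) (y : continuousCohomology 1 ρ.toTopRep) :
    (extOneEquivH1 ρ').symm ((ContinuousCohomology.map (ContinuousMonoidHom.id Γ) F 1).hom y) =
      ((extOneEquivH1 ρ).symm y).comp (Ext.mk₀ (homD ρ ρ' F)) (add_zero 1) := by
  apply (extOneEquivH1 ρ').injective
  rw [AddEquiv.apply_symm_apply, extOneEquivH1_apply, ← extOneToH1_naturality, ← extOneEquivH1_apply,
    AddEquiv.apply_symm_apply]

end ProfiniteNat

end ExtOneLayer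

end DiscreteRep

end Literature.Algebra.Homology

end
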